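import Literature.AlgebraicGeometry.HodgeTheory.SupportedLocusClosed
import Literature.NumberTheory.Transcendental.AnalytificationConnectedOpen
import HarnessLib

/-!
# The generic dichotomy for supported classes from generic topological triviality of the pair

Topic `Literature/AlgebraicGeometry/HodgeTheory` (family `hodge`), companion of
`SupportedLocusClosed` in the proof programme of the named fact
`charlesSchnell_algebraicityLocus_iUnion_closed` (`AlgebraicityLocus.lean`; Charles–Schnell,
*Notes on absolute Hodge classes*, proof of Prop. 11.3.11; Voisin, *Hodge Theory II*, §3.3.1,
§7.3.2). The assembly of that fact from a complete family of parameter spaces of supports needs,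
for every irreducible closed subset `Y` of a parameter space `H` carrying a closed family of
supports `𝒵 ⊆ 𝒳 × H`, the GENERIC DICHOTOMY: over some non-empty relatively open part of `Y`,
either `A|_{𝒳_{g(y)}}` dies off the slice `𝒵_y` at every complex point `y`, or at none. This file
reduces the dichotomy to ONE published input of a topological nature, in the style of
`SupportedLocusClosed`:

* `map_subtypeVal_eq_zero_iff_of_pairTrivialisation` — pure topology: for `p : E → B`,
  `h : Y → B`, `C ⊆ Y × E`, a class `A ∈ Hᵏ(E; F)` over a field and a TRIVIALISATION OF THE PAIR
  over a path connected `V ⊆ Y` (a homeomorphism `V × F₀ ≃ {(v, e) | p e = h v}` over `V` matching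
  `C` with `V × C₀`), the death of `A` on `p⁻¹(h y)` off the slice `C_y` is independent of
  `y ∈ V` (homotopy invariance of singular cohomology along paths in `V`);
* `dichotomy_of_pairTrivialisation` — on the real carriers: for `f : 𝒳 ⟶ S` proper, `g : H ⟶ S`
  locally of finite type, `𝒵 ⊆ 𝒳 × H`, `A ∈ Hᵏ(𝒳(ℂ); ℂ)`, `Y ⊆ H` closed irreducible and `O`
  open meeting `Y`: if the pair (`𝒳 ×_S H`, `𝒵`) is topologically locally trivial over
  `(Y ∩ O)(ℂ)` over path connected relatively open neighbourhoods (`htriv`), then the support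
  condition `A|_{𝒳_{g(y)}} ∈ ker (H → H((𝒳_{g(y)} ∖ 𝒵_y)(ℂ)))` holds at all complex points over
  `Y ∩ O` or at none — the condition is locally constant, and `(Y ∩ O)(ℂ)` is connected since
  `Y ∩ O` is irreducible (`Motives.ComplexPoints.isConnected_setOf_pt_mem_inter_of_isIrreducible`,
  SGA1 XII Prop. 2.4, proved in the tree).

The input `htriv` is, for the algebraic families of the structure theorem, the conclusion of
Verdier's generic local triviality theorem (J.-L. Verdier, *Stratifications de Whitney et
théorème de Bertini–Sard*, Invent. Math. 36 (1976), Cor. 5.1: a proper morphism of complex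
algebraic varieties is, over a dense Zariski-open subset of the base, a topologically locally
trivial stratified fibration compatible with a given closed subvariety), combined with the local
path-connectedness of complex analytic sets; neither is in the tree, and this file does not state
them (no new named facts): it isolates exactly what they must deliver.

## References

* [Verdier1976] J.-L. Verdier, Stratifications de Whitney et théorème de Bertini–Sard, Invent.
  Math. 36 (1976), 295–312, Cor. 5.1.
* [SGA1] A. Grothendieck, M. Raynaud, Revêtements étales et groupe fondamental, Exp. XII
  Prop. 2.4.
* [CharlesSchnell2014Notes] F. Charles, C. Schnell, Notes on absolute Hodge classes, in Hodge
  Theory (Princeton Math. Notes 49, 2014), Prop. 11.3.11 (proof).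
* [HatcherAT2002] A. Hatcher, Algebraic Topology (2002), Thm. 2.10, §3.1.
-/

noncomputable section

open CategoryTheory AlgebraicGeometry Limits Set MonoidalCategory CartesianMonoidalCategory
open _root_.Topology TopologicalSpace Filter unitInterval
open Literature.AlgebraicTopology.SingularHomology
open Literature.AlgebraicGeometry.Motives

universe u v

namespace Literature.AlgebraicGeometry.HodgeTheory

section HodgeTheory

/-! ### Pure topology: vanishing off the slices is constant under a trivialisation of the pair -/

section Topology

variable (F : Type v) [Field F]

/-- **Vanishing off the slices of a trivialised pair is constant along paths.** Let `p : E → B`,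
`h : Y → B`, `C ⊆ Y × E`, `A ∈ Hᵏ(E; F)`, and let `V ⊆ Y` be path connected and carry a
TRIVIALISATION OF THE PAIR over `V`: a homeomorphism `φ : V × F₀ ≃ {(v, e) | p e = h v}` over `V`
under which `C` corresponds to `V × C₀` for a fixed `C₀ ⊆ F₀`. Then for `y, y' ∈ V`, `A` dies on the
fibre `p⁻¹(h y)` off the slice `C_y` iff it dies on `p⁻¹(h y')` off `C_{y'}`: both are equivalent
to the death of `A` under `F₀ ∖ C₀ → E`, `e₀ ↦ φ(v, e₀)`, for `v = y, y'`, two maps which are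
homotopic along a path from `y` to `y'` in `V` (homotopy invariance of singular cohomology).
[cite: HatcherAT2002, Thm. 2.10 and §3.1] -/
theorem map_subtypeVal_eq_zero_iff_of_pairTrivialisation {E B Y : Type u} [TopologicalSpace E]
    [TopologicalSpace B] [TopologicalSpace Y] (p : E → B) (h : Y → B) (C : Set (Y × E)) {k : ℕ}
    (A : singularCohomology F F E k) {V : Set Y} (hV : IsPathConnected V) {F₀ : Type u}
    [TopologicalSpace F₀] (C₀ : Set F₀) (φ : ↥V × F₀ ≃ₜ {q : ↥V × E // p q.2 = h q.1})
    (hφ₁ : ∀ x, (φ x).1.1 = x.1) (hφ₂ : ∀ x, (((φ x).1.1 : Y), (φ x).1.2) ∈ C ↔ x.2 ∈ C₀)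
    {y y' : Y} (hy : y ∈ V) (hy' : y' ∈ V) :
    singularCohomology.map F F (⟨Subtype.val, continuous_subtype_val⟩ :
        C({e : E // p e = h y ∧ (y, e) ∉ C}, E)) k A = 0 ↔
      singularCohomology.map F F (⟨Subtype.val, continuous_subtype_val⟩ :
        C({e : E // p e = h y' ∧ (y', e) ∉ C}, E)) k A = 0 := by
  -- the part of `F₀` off `C₀` and its motion `m v : F₀ ∖ C₀ → E` over `v ∈ V`
  let K : Type u := {e₀ : F₀ // e₀ ∉ C₀}
  have hcont : Continuous fun x : ↥V × F₀ => ((φ x).1.2 : E) :=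
    continuous_snd.comp (continuous_subtype_val.comp φ.continuous)
  let m : ↥V → C(K, E) := fun v =>
    ⟨fun e₀ => (φ (v, e₀.1)).1.2, hcont.comp (continuous_const.prodMk continuous_subtype_val)⟩
  -- key: for `v ∈ V`, death off the slice at `v` iff death under `m v`
  have hkey : ∀ v : ↥V, singularCohomology.map F F (⟨Subtype.val, continuous_subtype_val⟩ :
      C({e : E // p e = h v ∧ ((v : Y), e) ∉ C}, E)) k A = 0 ↔
        singularCohomology.map F F (m v) k A = 0 := by
    intro v
    -- `m v` factors through the fibre off the slice, homeomorphically
    have hn : ∀ e₀ : K, p (φ (v, e₀.1)).1.2 = h v ∧ ((v : Y), ((φ (v, e₀.1)).1.2 : E)) ∉ C := by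
      intro e₀
      have h1 : (φ (v, e₀.1)).1.1 = v := hφ₁ (v, e₀.1)
      refine ⟨?_, fun hC => e₀.2 ((hφ₂ (v, e₀.1)).1 ?_)⟩
      · have h2 := (φ (v, e₀.1)).2
        rwa [h1] at h2
      · rwa [h1]
    let n : C(K, {e : E // p e = h v ∧ ((v : Y), e) ∉ C}) :=
      ⟨fun e₀ => ⟨(φ (v, e₀.1)).1.2, hn e₀⟩,
        (hcont.comp (continuous_const.prodMk continuous_subtype_val)).subtype_mk _⟩
    have hi : ∀ w : {e : E // p e = h v ∧ ((v : Y), e) ∉ C},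
        (φ.symm ⟨(v, w.1), w.2.1⟩).2 ∉ C₀ := by
      intro w hw
      have h2 := (hφ₂ (φ.symm ⟨(v, w.1), w.2.1⟩)).2 hw
      rw [Homeomorph.apply_symm_apply] at h2
      exact w.2.2 h2
    let i : C({e : E // p e = h v ∧ ((v : Y), e) ∉ C}, K) :=
      ⟨fun w => ⟨(φ.symm ⟨(v, w.1), w.2.1⟩).2, hi w⟩,
        (continuous_snd.comp (φ.symm.continuous.comp
          ((continuous_const.prodMk continuous_subtype_val).subtype_mk _))).subtype_mk _⟩
    have hfac₁ : m v = (⟨Subtype.val, continuous_subtype_val⟩ :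
        C({e : E // p e = h v ∧ ((v : Y), e) ∉ C}, E)).comp n := by
      ext e₀
      rfl
    have hfac₂ : (⟨Subtype.val, continuous_subtype_val⟩ :
        C({e : E // p e = h v ∧ ((v : Y), e) ∉ C}, E)) = (m v).comp i := by
      ext w
      have h1 : (φ.symm ⟨(v, w.1), w.2.1⟩).1 = v := by
        have h := hφ₁ (φ.symm ⟨(v, w.1), w.2.1⟩)
        rw [Homeomorph.apply_symm_apply] at h
        exact h.symm
      change w.1 = ((φ (v, (φ.symm ⟨(v, w.1), w.2.1⟩).2)).1.2 : E)
      have hq : (v, (φ.symm ⟨(v, w.1), w.2.1⟩).2) = φ.symm ⟨(v, w.1), w.2.1⟩ :=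
        Prod.ext h1.symm rfl
      rw [hq, Homeomorph.apply_symm_apply]
    constructor
    · intro h0
      rw [hfac₁, singularCohomology.map_comp, ModuleCat.comp_apply, h0, map_zero]
    · intro h0
      rw [hfac₂, singularCohomology.map_comp, ModuleCat.comp_apply, h0, map_zero]
  -- the motions at `y` and `y'` are homotopic along a path in `V`
  haveI : PathConnectedSpace ↥V := isPathConnected_iff_pathConnectedSpace.1 hV
  let γ : Path (⟨y, hy⟩ : ↥V) ⟨y', hy'⟩ := PathConnectedSpace.somePath _ _
  have hhom : (m ⟨y, hy⟩).Homotopic (m ⟨y', hy'⟩) := by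
    refine ⟨{ toFun := fun x => (φ (γ x.1, x.2.1)).1.2
              continuous_toFun := hcont.comp ((γ.continuous.comp continuous_fst).prodMk
                (continuous_subtype_val.comp continuous_snd))
              map_zero_left := fun e₀ => by simp [m, γ.source]
              map_one_left := fun e₀ => by simp [m, γ.target] }⟩
  rw [hkey ⟨y, hy⟩, hkey ⟨y', hy'⟩, singularCohomology.map_eq_of_homotopic' F F hhom k]

end Topology

/-! ### The generic dichotomy from local trivialisations of the pair over a dense open part -/

section Schemes

variable {𝒳 S H : Motives.SchemeOver ℂ} (f : 𝒳 ⟶ S)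

/-- **The generic dichotomy from generic topological triviality of the pair** (the hypothesis
`hdich` of `algebraicityLocus_eq_iUnion_of_dichotomy`, for the support condition, reduced to a
published input). Let `f : 𝒳 ⟶ S` be proper with `𝒳` separated over `ℂ`, `g : H ⟶ S` a parameter
`ℂ`-scheme locally of finite type, `𝒵 ⊆ 𝒳 × H` (a family of supports), `A ∈ Hᵏ(𝒳(ℂ); ℂ)`,
`Y ⊆ H` closed irreducible and `O ⊆ H` open meeting `Y`. Suppose that the pair of families
(`𝒳 ×_S H`, `𝒵`) is TOPOLOGICALLY LOCALLY TRIVIAL over `(Y ∩ O)(ℂ)` in the strong topology, over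
path connected relatively open neighbourhoods (`htriv`; for the witness families of the structure
theorem this is Verdier's generic local triviality theorem for proper algebraic morphisms with a
closed subfamily, Verdier 1976 Cor. 5.1, together with the local path-connectedness of complex
analytic sets). Then EITHER `A|_{𝒳_{g(y)}}` dies off the slice `𝒵_y` at every complex point `y`
over `Y ∩ O`, OR at none: by `map_subtypeVal_eq_zero_iff_of_pairTrivialisation` the condition is
locally constant on `(Y ∩ O)(ℂ)`, which is connected because `Y ∩ O` is irreducible
(`Motives.ComplexPoints.isConnected_setOf_pt_mem_inter_of_isIrreducible`, SGA1 XII 2.4).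
[cite: Verdier1976, Cor. 5.1] [cite: SGA1, Exp. XII Prop. 2.4]
[cite: CharlesSchnell2014Notes, Prop. 11.3.11 (proof)] -/
theorem dichotomy_of_pairTrivialisation [IsProper f.left] [IsSeparated 𝒳.hom]
    [LocallyOfFiniteType H.hom] (g : H ⟶ S) (𝒵 : Set (𝒳 ⊗ H).left) (k : ℕ)
    (A : complexBetti 𝒳 k) {Y : Set H.left} (hYc : IsClosed Y) (hY : IsIrreducible Y)
    (O : H.left.Opens) (hYO : (Y ∩ (O : Set H.left)).Nonempty)
    (htriv : ∀ y₀ : Motives.ComplexPoints H, y₀.pt ∈ Y ∧ y₀.pt ∈ (O : Set H.left) →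
      ∃ V : Set (Motives.ComplexPoints H),
        V ⊆ {y | y.pt ∈ Y ∧ y.pt ∈ (O : Set H.left)} ∧
        V ∈ 𝓝[{y | y.pt ∈ Y ∧ y.pt ∈ (O : Set H.left)}] y₀ ∧ IsPathConnected V ∧
        ∃ (F₀ : Type) (_ : TopologicalSpace F₀) (C₀ : Set F₀)
          (φ : ↥V × F₀ ≃ₜ {q : ↥V × Motives.ComplexPoints 𝒳 //
            AlgPoints.map f q.2 = AlgPoints.map g q.1.1}),
          (∀ x, (φ x).1.1 = x.1) ∧
          (∀ x, (AlgPoints.prodEquiv.symm ((φ x).1.2, ((φ x).1.1 : Motives.ComplexPoints H)) :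
              Motives.ComplexPoints (𝒳 ⊗ H)).pt ∈ 𝒵 ↔ x.2 ∈ C₀)) :
    (∀ y : Motives.ComplexPoints H, y.pt ∈ Y ∧ y.pt ∈ (O : Set H.left) →
      complexBetti.map (Motives.fiberι f (AlgPoints.map g y)) k A ∈
        LinearMap.ker (complexBetti.restrictCompl (Motives.fiberOver f (AlgPoints.map g y))
          ((lift (Motives.fiberι f (AlgPoints.map g y))
            (Motives.fiberOverToSpec f (AlgPoints.map g y) ≫ y)).left.base ⁻¹' 𝒵) k).hom) ∨
    (∀ y : Motives.ComplexPoints H, y.pt ∈ Y ∧ y.pt ∈ (O : Set H.left) →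
      complexBetti.map (Motives.fiberι f (AlgPoints.map g y)) k A ∉
        LinearMap.ker (complexBetti.restrictCompl (Motives.fiberOver f (AlgPoints.map g y))
          ((lift (Motives.fiberι f (AlgPoints.map g y))
            (Motives.fiberOverToSpec f (AlgPoints.map g y) ≫ y)).left.base ⁻¹' 𝒵) k).hom) := by
  -- the good set, translated to vanishing off the slices of `C = {(y, Q) | (Q, y) ∈ 𝒵(ℂ)}`
  let C : Set (Motives.ComplexPoints H × Motives.ComplexPoints 𝒳) :=
    {x | (AlgPoints.prodEquiv.symm (x.2, x.1) : Motives.ComplexPoints (𝒳 ⊗ H)).pt ∈ 𝒵}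
  let O' : Set (Motives.ComplexPoints H) := {y | y.pt ∈ Y ∧ y.pt ∈ (O : Set H.left)}
  have hT : ∀ y : Motives.ComplexPoints H,
      complexBetti.map (Motives.fiberι f (AlgPoints.map g y)) k A ∈
        LinearMap.ker (complexBetti.restrictCompl (Motives.fiberOver f (AlgPoints.map g y))
          ((lift (Motives.fiberι f (AlgPoints.map g y))
            (Motives.fiberOverToSpec f (AlgPoints.map g y) ≫ y)).left.base ⁻¹' 𝒵) k).hom ↔
      singularCohomology.map ℂ ℂ (⟨Subtype.val, continuous_subtype_val⟩ :
        C({e : Motives.ComplexPoints 𝒳 // AlgPoints.map f e = AlgPoints.map g y ∧ (y, e) ∉ C},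
          Motives.ComplexPoints 𝒳)) k A = 0 := fun y =>
    map_fiberι_mem_ker_restrictCompl_iff f (AlgPoints.map g) C
      (fun y => (lift (Motives.fiberι f (AlgPoints.map g y))
        (Motives.fiberOverToSpec f (AlgPoints.map g y) ≫ y)).left.base ⁻¹' 𝒵)
      (fun y P => pt_mem_preimage_lift_iff f g 𝒵 y P) k A y
  -- `O'` is connected (SGA1 XII 2.4 for the irreducible `Y ∩ O`)
  have hconn : IsConnected O' :=
    Motives.ComplexPoints.isConnected_setOf_pt_mem_inter_of_isIrreducible H hYc hY O hYO
  haveI : PreconnectedSpace ↥O' := Subtype.preconnectedSpace hconn.isPreconnected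
  -- the vanishing condition is locally constant on `O'`
  let T : ↥O' → Prop := fun y =>
    singularCohomology.map ℂ ℂ (⟨Subtype.val, continuous_subtype_val⟩ :
      C({e : Motives.ComplexPoints 𝒳 //
          AlgPoints.map f e = AlgPoints.map g y.1 ∧ ((y.1 : Motives.ComplexPoints H), e) ∉ C},
        Motives.ComplexPoints 𝒳)) k A = 0
  have hlc : IsLocallyConstant T := by
    rw [IsLocallyConstant.iff_eventually_eq]
    intro y₀
    obtain ⟨V, hVsub, hVn, hVpc, F₀, _, C₀, φ, hφ₁, hφ₂⟩ := htriv y₀.1 y₀.2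
    have hy₀V : (y₀ : Motives.ComplexPoints H) ∈ V := mem_of_mem_nhdsWithin y₀.2 hVn
    have hVn' : Subtype.val ⁻¹' V ∈ 𝓝 y₀ := preimage_coe_mem_nhds_subtype.2 hVn
    filter_upwards [hVn'] with y hy
    exact propext (map_subtypeVal_eq_zero_iff_of_pairTrivialisation ℂ (AlgPoints.map f)
      (AlgPoints.map g) C A hVpc C₀ φ hφ₁ hφ₂ hy hy₀V)
  -- hence constant
  by_cases hex : ∃ y₁ : ↥O', T y₁
  · obtain ⟨y₁, hy₁⟩ := hex
    refine Or.inl fun y hy => (hT y).2 ?_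
    have h : T ⟨y, hy⟩ = T y₁ := hlc.apply_eq_of_preconnectedSpace ⟨y, hy⟩ y₁
    exact Eq.mp h.symm hy₁
  · push Not at hex
    exact Or.inr fun y hy hgood => hex ⟨y, hy⟩ ((hT y).1 hgood)

end Schemes

end HodgeTheory

end Literature.AlgebraicGeometry.HodgeTheory

end
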